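import Literature.RepresentationTheory.CompactGroups.GelfandTrickOrbitalOperators
import Literature.RepresentationTheory.KonnoKonno2007.UnitaryRankOneTransposeConjugate
import Literature.RepresentationTheory.BorelWallach2000.UpqMaximalCompactBlocks
import HarnessLib

/-!
# `U(2,1)`: the orbital operators of every unitary representation commute (Gelfand's trick for the transpose)

Topic `RepresentationTheory/KonnoKonno2007`; namespace `Literature.RepresentationTheory.KonnoKonno2007.RealDualPair`
(continues ★ `UnitaryRankOneTransposeConjugate`).  Theorems only; no definition, no instance, no named fact, no `sorry`.

For the linear real group `U(2,1) = uFormGroup (Fin 2) (Fin 1)` (★ `JunctionLinearRealGroup`; carrier `UForm (Fin 2) (Fin 1)`)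
with compact subgroup `K = U(2) × U(1)` embedded by `ιK = incl ∘ upqMaximalCompactEquiv⁻¹` (★ `UpqMaximalCompactBlocks`,
`= UForm.kV` on matrices), and ANY unitary strongly continuous representation `σ` of `U(2,1)` on a Hilbert space, the
orbital operators `O_x = ∫_K σ(ιk · x · ιk⁻¹) dμ(k)` (★ `CompactGroups.orbitalOp`, `μ` a two-sided and inversion invariant
probability measure on `K`) PAIRWISE COMMUTE:

  **`commute_orbitalOp_uFormGroup_two_one`**.

This is ★ Gelfand's trick `CompactGroups.commute_orbitalOp_of_antiHom` for the anti-automorphism `g ↦ gᵀ` of `U(2,1)`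
(`exists_transposeMap`: the element with matrix `gᵀ`, an anti-homomorphism), compatible with `K` through the continuous
automorphism `θ(u, z) = (ū, z̄)` of `U(2) × U(1)` (`exists_KV_conjAut`; `(ιK k)ᵀ = ιK (θ k)⁻¹` since `ūᵀ = u⁻¹`), which preserves the Haar
probability measure (Mathlib `MonoidHom.measurePreserving`), and for which every `gᵀ` is `K`-conjugate to `g`
(★ `exists_kV_conj_eq_transpose`: `KAK`, Weyl element, phase lemma).  With ★ `KTypeMultiplicityOneOfCommutingOrbital` it yields
multiplicity one of `K`-types for irreducible unitary representations of `U(2,1)`, i.e. Harish-Chandra's admissibility theorem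
[HarishChandra1953, Thms. 4–6] at `U(2,1)` (★ `GKModulesAdmissibleUnitaryTwoOne`).

* `exists_KV_conjAut` — the entrywise-conjugation automorphism `θ` of `U(2) × U(β)` as a `ContinuousMulEquiv`;
* `exists_transposeMap` — the transpose as a self-map of the carrier of `U(2,1)`: anti-homomorphism, `(ιK k)ᵀ = ιK (θk)⁻¹`,
  `gᵀ ∈ Ad(K) g`;
* (private) `measurePreserving_of_continuousMulEquiv` — a continuous automorphism of a compact group preserves a Haar probability measure;
* **`commute_orbitalOp_uFormGroup_two_one`**.

## References
* S. Helgason, *Groups and Geometric Analysis*, AMS (2000), Ch. IV §3, Thm. 3.1 [Helgason2000].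
* Harish-Chandra, *Representations of a semisimple Lie group on a Banach space. I*, Trans. AMS 75 (1953), Thms. 4–6 [HarishChandra1953].
* K. Konno, T. Konno, Kyushu J. Math. 61 (2007), §3.1 (the frame `U(2,1) ⊃ U(2) × U(1)`) [KonnoKonno2007].

## Provenance
Cell `hodgecm-mathlib`, seat A-p14 (g27), road «T3 in-house via Gelfand's trick», FILE D1.  HC_CM is proved only modulo the printed
citations until rung 0 closes; this file changes no count.
-/

set_option autoImplicit false

noncomputable section

open MeasureTheory Matrix Complex
open scoped ComplexConjugate

namespace Literature.RepresentationTheory.KonnoKonno2007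

namespace RealDualPair

open Literature.NumberTheory.Automorphic Literature.RepresentationTheory.BorelWallach2000
open Literature.RepresentationTheory.CompactGroups

variable {β : Type*} [Fintype β] [DecidableEq β]

/-! ## 1. The conjugation automorphism `θ (u, z) = (ū, z̄)` of `K = U(2) × U(β)` -/

omit [Fintype β] in
/-- Entrywise `star` on unitary matrices is multiplicative. [folklore] -/
private theorem unitaryGroup_map_star_mul {n : Type*} [Fintype n] [DecidableEq n] (u v : Matrix.unitaryGroup n ℂ) :
    Matrix.UnitaryGroup.map_star (u * v) = Matrix.UnitaryGroup.map_star u * Matrix.UnitaryGroup.map_star v := by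
  apply Subtype.ext
  change ((u : Matrix n n ℂ) * (v : Matrix n n ℂ)).map star = (u : Matrix n n ℂ).map star * (v : Matrix n n ℂ).map star
  have hstar : (star : ℂ → ℂ) = (starRingEnd ℂ : ℂ → ℂ) := rfl
  rw [hstar, Matrix.map_mul]

omit [Fintype β] in
/-- Entrywise `star` on unitary matrices is an involution. [folklore] -/
private theorem unitaryGroup_map_star_map_star {n : Type*} [Fintype n] [DecidableEq n] (u : Matrix.unitaryGroup n ℂ) :
    Matrix.UnitaryGroup.map_star (Matrix.UnitaryGroup.map_star u) = u := by
  apply Subtype.ext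
  change ((u : Matrix n n ℂ).map star).map star = (u : Matrix n n ℂ)
  rw [Matrix.map_map]
  have : (star ∘ star : ℂ → ℂ) = id := funext fun z => star_star z
  rw [this, Matrix.map_id]

omit [Fintype β] in
/-- Entrywise `star` on unitary matrices is continuous. [folklore] -/
private theorem unitaryGroup_continuous_map_star {n : Type*} [Fintype n] [DecidableEq n] :
    Continuous (Matrix.UnitaryGroup.map_star : Matrix.unitaryGroup n ℂ → Matrix.unitaryGroup n ℂ) :=
  Continuous.subtype_mk (continuous_subtype_val.matrix_map continuous_star) _

/-- **The conjugation automorphism `θ(u, z) = (ū, z̄)` of `K = U(2) × U(β)`** as an isomorphism of topological groups, with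
`θ(k)⁻¹ = kᵀ` componentwise. [cite: KonnoKonno2007, §3.1] -/
theorem exists_KV_conjAut :
    ∃ θ : KV (Fin 2) β ≃ₜ* KV (Fin 2) β, ∀ k : KV (Fin 2) β,
      (θ k)⁻¹ = (Matrix.UnitaryGroup.transpose k.1, Matrix.UnitaryGroup.transpose k.2) := by
  refine ⟨{ toFun := fun k => (Matrix.UnitaryGroup.map_star k.1, Matrix.UnitaryGroup.map_star k.2)
            invFun := fun k => (Matrix.UnitaryGroup.map_star k.1, Matrix.UnitaryGroup.map_star k.2)
            left_inv := fun k => Prod.ext (unitaryGroup_map_star_map_star k.1) (unitaryGroup_map_star_map_star k.2)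
            right_inv := fun k => Prod.ext (unitaryGroup_map_star_map_star k.1) (unitaryGroup_map_star_map_star k.2)
            map_mul' := fun k k' => Prod.ext (unitaryGroup_map_star_mul k.1 k'.1) (unitaryGroup_map_star_mul k.2 k'.2)
            continuous_toFun := (unitaryGroup_continuous_map_star.comp continuous_fst).prodMk (unitaryGroup_continuous_map_star.comp continuous_snd)
            continuous_invFun := (unitaryGroup_continuous_map_star.comp continuous_fst).prodMk (unitaryGroup_continuous_map_star.comp continuous_snd) },
    fun k => ?_⟩
  change (Matrix.UnitaryGroup.map_star k.1, Matrix.UnitaryGroup.map_star k.2)⁻¹ = _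
  rw [Prod.inv_mk, Matrix.UnitaryGroup.map_star_inv_eq_transpose, Matrix.UnitaryGroup.map_star_inv_eq_transpose]

/-! ## 2. The transpose as a self-map of the carrier of `U(2,1)` -/

/-- **The transpose on `U(2,1)`**: there is a self-map `σ` of the carrier of `uFormGroup (Fin 2) β` (`|β| = 1`) whose value at `g`
has matrix `gᵀ`; it is an anti-homomorphism, it maps `ιK k = kV k` to `ιK (θ k)⁻¹ = kV kᵀ`, and every `σ g` is `K`-conjugate to `g`
(★ `exists_kV_conj_eq_transpose`). [cite: KonnoKonno2007, §3.1] [cite: HarishChandra1953, Thms. 4–6] -/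
theorem exists_transposeMap [Unique β] :
    ∃ σ : ↥(uFormGroup (Fin 2) β).carrier → ↥(uFormGroup (Fin 2) β).carrier,
      (∀ g, (((σ g : ↥(uFormGroup (Fin 2) β).carrier) : GL (Fin 2 ⊕ β) ℂ) : Matrix (Fin 2 ⊕ β) (Fin 2 ⊕ β) ℂ) =
          ((((g : ↥(uFormGroup (Fin 2) β).carrier) : GL (Fin 2 ⊕ β) ℂ) : Matrix (Fin 2 ⊕ β) (Fin 2 ⊕ β) ℂ))ᵀ) ∧
      (∀ a b, σ (a * b) = σ b * σ a) ∧
      (∀ g, ∃ u : KV (Fin 2) β,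
          σ g = Subgroup.inclusion (uFormGroup (Fin 2) β).maximalCompact_le_carrier (upqMaximalCompactEquiv.symm u) * g *
            (Subgroup.inclusion (uFormGroup (Fin 2) β).maximalCompact_le_carrier (upqMaximalCompactEquiv.symm u))⁻¹) := by
  -- the value: the `K`-conjugate of ★ `exists_kV_conj_eq_transpose`, whose matrix is `gᵀ`
  classical
  let σ : ↥(uFormGroup (Fin 2) β).carrier → ↥(uFormGroup (Fin 2) β).carrier := fun g =>
    Subgroup.inclusion (uFormGroup (Fin 2) β).maximalCompact_le_carrier
        (upqMaximalCompactEquiv.symm (Classical.choose (exists_kV_conj_eq_transpose (β := β) g))) * g *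
      (Subgroup.inclusion (uFormGroup (Fin 2) β).maximalCompact_le_carrier
        (upqMaximalCompactEquiv.symm (Classical.choose (exists_kV_conj_eq_transpose (β := β) g))))⁻¹
  have hσ : ∀ g, (((σ g : ↥(uFormGroup (Fin 2) β).carrier) : GL (Fin 2 ⊕ β) ℂ) : Matrix (Fin 2 ⊕ β) (Fin 2 ⊕ β) ℂ) =
      ((((g : ↥(uFormGroup (Fin 2) β).carrier) : GL (Fin 2 ⊕ β) ℂ) : Matrix (Fin 2 ⊕ β) (Fin 2 ⊕ β) ℂ))ᵀ := fun g =>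
    Classical.choose_spec (exists_kV_conj_eq_transpose (β := β) g)
  refine ⟨σ, hσ, fun a b => ?_, fun g => ⟨Classical.choose (exists_kV_conj_eq_transpose (β := β) g), rfl⟩⟩
  -- anti-homomorphism: compare matrices
  apply Subtype.ext
  apply Units.ext
  rw [hσ, Subgroup.coe_mul, Units.val_mul, Matrix.transpose_mul, Subgroup.coe_mul, Units.val_mul, hσ, hσ]

/-! ## 3. Continuous automorphisms of a compact group preserve a Haar probability measure -/

/-- A continuous automorphism `θ` of a compact group preserves every Haar probability measure (Mathlib
`MonoidHom.measurePreserving`: `θ_* μ` is a Haar probability measure, hence `= μ`). [folklore] -/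
private theorem measurePreserving_of_continuousMulEquiv {K : Type*} [Group K] [TopologicalSpace K] [IsTopologicalGroup K]
    [CompactSpace K] [MeasurableSpace K] [BorelSpace K] (μ : Measure K) [μ.IsHaarMeasure] (θ : K ≃ₜ* K) :
    MeasurePreserving θ μ μ :=
  θ.toMulEquiv.toMonoidHom.measurePreserving θ.continuous θ.surjective rfl

/-! ## 4. The orbital operators of a unitary representation of `U(2,1)` commute -/

/-- **Gelfand's trick at `U(2,1)`.**  For every unitary strongly continuous representation `σ` of the carrier of
`U(2,1) = uFormGroup (Fin 2) β` (`|β| = 1`) and every two-sided and inversion invariant Haar probability measure `μ` on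
`K = U(2) × U(β)` (embedded by `ιK = incl ∘ upqMaximalCompactEquiv⁻¹`), the orbital operators
`O_x = ∫_K σ(ιk · x · ιk⁻¹) dμ(k)` pairwise commute. [cite: Helgason2000, Ch. IV §3 Thm. 3.1] [cite: HarishChandra1953, Thms. 4–6] -/
theorem commute_orbitalOp_uFormGroup_two_one [Unique β] [MeasurableSpace (KV (Fin 2) β)] [BorelSpace (KV (Fin 2) β)]
    [CompactSpace (KV (Fin 2) β)] [SecondCountableTopology (KV (Fin 2) β)]
    (μ : Measure (KV (Fin 2) β)) [μ.IsHaarMeasure] [IsProbabilityMeasure μ] [μ.IsMulRightInvariant] [μ.IsInvInvariant]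
    {E : Type*} [NormedAddCommGroup E] [InnerProductSpace ℂ E] [CompleteSpace E]
    (π : ContRepresentation ℂ ↥(uFormGroup (Fin 2) β).carrier E) (hπ : π.IsStronglyContinuous) (hU : π.IsUnitary)
    (hι : Continuous ((Subgroup.inclusion (uFormGroup (Fin 2) β).maximalCompact_le_carrier).comp
      (upqMaximalCompactEquiv (α := Fin 2) (β := β)).symm.toMulEquiv.toMonoidHom))
    (x y : ↥(uFormGroup (Fin 2) β).carrier) :
    Commute
      (orbitalOp μ ((Subgroup.inclusion (uFormGroup (Fin 2) β).maximalCompact_le_carrier).comp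
        (upqMaximalCompactEquiv (α := Fin 2) (β := β)).symm.toMulEquiv.toMonoidHom) π hι hπ hU x)
      (orbitalOp μ ((Subgroup.inclusion (uFormGroup (Fin 2) β).maximalCompact_le_carrier).comp
        (upqMaximalCompactEquiv (α := Fin 2) (β := β)).symm.toMulEquiv.toMonoidHom) π hι hπ hU y) := by
  obtain ⟨θ, hθ⟩ := exists_KV_conjAut (β := β)
  obtain ⟨σ, hσmat, hσmul, hσconj⟩ := exists_transposeMap (β := β)
  set ιK : KV (Fin 2) β →* ↥(uFormGroup (Fin 2) β).carrier :=
    (Subgroup.inclusion (uFormGroup (Fin 2) β).maximalCompact_le_carrier).comp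
      (upqMaximalCompactEquiv (α := Fin 2) (β := β)).symm.toMulEquiv.toMonoidHom with hιK
  -- the matrix of `ιK k` is that of `kV k`
  have hιmat : ∀ k : KV (Fin 2) β, (((ιK k : ↥(uFormGroup (Fin 2) β).carrier) : GL (Fin 2 ⊕ β) ℂ) :
      Matrix (Fin 2 ⊕ β) (Fin 2 ⊕ β) ℂ) = (((UForm.kV (Fin 2) β k : UForm (Fin 2) β) : GL (Fin 2 ⊕ β) ℂ) :
        Matrix (Fin 2 ⊕ β) (Fin 2 ⊕ β) ℂ) := fun k => rfl
  -- compatibility of the transpose with `K` through `θ`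
  have hσι : ∀ k, σ (ιK k) = (ιK (θ k))⁻¹ := by
    intro k
    rw [← map_inv, hθ k]
    apply Subtype.ext
    apply Units.ext
    rw [hσmat, hιmat, hιmat, coe_kV_transpose]
  refine commute_orbitalOp_of_antiHom hσmul θ (measurePreserving_of_continuousMulEquiv μ θ) hσι ?_ x y
  intro z
  obtain ⟨u, hu⟩ := hσconj z
  exact ⟨u, hu⟩

end RealDualPair

end Literature.RepresentationTheory.KonnoKonno2007

end
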